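import Mathlib

/-!
# Support bound for block-moving permutations

Solo study `solo-HodgeConjecture-blind`, session s42 (work/s42/type1-imprimitive.md §9a).

If a permutation `g` preserves an equivalence relation `r` (a block system) and moves the class
of `a` (`¬ r a (g a)`), then that class and its image are disjoint subsets of the support of `g`;
hence twice the size of the class is at most the size of the support.  This unifies the lemmas
"transpositions and 3-cycles never move non-singleton blocks" and "double transpositions move only
pairs" of the pairing theorem: a local monodromy of support `s` moves blocks of size `≤ s / 2` only.
-/

namespace Summit.HodgeConjecture.HodgeConjecture.Theorems.SupportBound

open Equiv

variable {α : Type*}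

/-- A moved class lies inside the support: no point of the class of `a` is fixed by `g`. -/
theorem moved_class_not_fixed {r : α → α → Prop} (hr : Equivalence r) {g : Perm α}
    (hinv : ∀ x y, r (g x) (g y) ↔ r x y) {a : α} (hmove : ¬ r a (g a))
    {x : α} (hx : r a x) : g x ≠ x := by
  intro hfix
  have h1 := (hinv a x).2 hx
  rw [hfix] at h1
  exact hmove (hr.trans hx (hr.symm h1))

/-- The image of a moved class lies inside the support as well. -/
theorem moved_class_image_not_fixed {r : α → α → Prop} (hr : Equivalence r) {g : Perm α}
    (hinv : ∀ x y, r (g x) (g y) ↔ r x y) {a : α} (hmove : ¬ r a (g a))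
    {x : α} (hx : r a x) : g (g x) ≠ g x := by
  intro hfix
  exact moved_class_not_fixed hr hinv hmove hx (g.injective hfix)

/-- A moved class is disjoint from its image. -/
theorem moved_class_disjoint_image {r : α → α → Prop} (hr : Equivalence r) {g : Perm α}
    (hinv : ∀ x y, r (g x) (g y) ↔ r x y) {a : α} (hmove : ¬ r a (g a))
    {x y : α} (hx : r a x) (hy : r a y) : g x ≠ y := by
  intro hxy
  have h1 := (hinv a x).2 hx
  rw [hxy] at h1
  exact hmove (hr.trans hy (hr.symm h1))

/-- SUPPORT BOUND: twice the size of a moved class is at most the size of the support. -/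
theorem two_mul_card_class_le_card_support [Fintype α] [DecidableEq α]
    {r : α → α → Prop} [DecidableRel r] (hr : Equivalence r) {g : Perm α}
    (hinv : ∀ x y, r (g x) (g y) ↔ r x y) {a : α} (hmove : ¬ r a (g a)) :
    2 * (Finset.univ.filter (fun x => r a x)).card ≤ g.support.card := by
  set K : Finset α := Finset.univ.filter (fun x => r a x) with hK
  have hmemK : ∀ x, x ∈ K ↔ r a x := by
    intro x
    simp [hK]
  have hdisj : Disjoint K (K.image g) := by
    rw [Finset.disjoint_left]
    intro y hy hy'
    rw [Finset.mem_image] at hy'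
    obtain ⟨x, hx, hxy⟩ := hy'
    exact moved_class_disjoint_image hr hinv hmove ((hmemK x).1 hx) ((hmemK y).1 hy) hxy
  have hsub : K.disjUnion (K.image g) hdisj ⊆ g.support := by
    intro y hy
    rw [Finset.mem_disjUnion] at hy
    rw [Perm.mem_support]
    rcases hy with hy | hy
    · exact moved_class_not_fixed hr hinv hmove ((hmemK y).1 hy)
    · rw [Finset.mem_image] at hy
      obtain ⟨x, hx, rfl⟩ := hy
      exact moved_class_image_not_fixed hr hinv hmove ((hmemK x).1 hx)
  have hcard := Finset.card_le_card hsub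
  rw [Finset.card_disjUnion, Finset.card_image_of_injective K g.injective] at hcard
  omega

end Summit.HodgeConjecture.HodgeConjecture.Theorems.SupportBound
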